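import Summits.QuantumFields.YangMills.Theorems.BalabanUVNodesN15KingModelFullPropagatorRate
import Summits.QuantumFields.YangMills.Theorems.BalabanUVNodesN15KingModelSlicesExactMassGrad

/-!
# BalabanUVNodes ∕ N15 — THE KING-MODEL RUNG, CURVED EDITION (PART O-a′): THE GRADIENT `∂^η_μG^η_K` OF THE FULL `A = 0` FLUCTUATION
# PROPAGATOR — UNIFORM OFF-DIAGONAL EXPONENTIAL DECAY, by the induction of part O-a on the DIFFERENTIATED peel
# `L^{K+1}[G_{K+1}(flatten(x + e_μ), ·) − G_{K+1}(flatten x, ·)] = (L^{d+1}∕L)·[∂G_K^{sub} + (∂ℋ_K)C^{(K)}ℋ_Kᵀ]`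
# (Track A, DAG node N15 = NE2; FAN-OUT v1.1 §N15 s3 «KING-MODEL RUNG … + the one-line statement of what the curved case adds»)

HONEST FRAMING.  Count-neutral kernel bookkeeping (cell `pub-ymgap`, seat `pub-ymgap-dag-n15-e` g6; `--supports stmt-QuantumFields-19912
--as helper` = K3‴ `SpineGivenEndpointR13`, lineage K3 19676 → K3′ 19908).  TEMPLATE LITERATURE, `A = 0`: C. King's scalar U(1)-Higgs MODEL
on finite tori ([King1986] (2.13)–(2.17) p. 653, (2.20) p. 654, Theorem 3.3 (3.7) p. 658 (derivative clause, sup-norm form), Prop. 3.7 (3.63)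
p. 663 (the printed gradient decay is slice-by-slice — the full-propagator statement below is its (2.17)-summed analogue, NOT a printed
proposition), §4 p. 675 (4.42)–(4.44)), NOT Bałaban's covariant objects; NE2⁺ is NOT PRINTED for those and not proved here; NOT a node
discharge; nothing continuum ∕ ℝ⁴ ∕ OS ∕ mass-gap ∕ Clay.  0 `sorry`, 0 `def`, standard axioms.

THE POINT.  Part O-a (`…N15KingModelFullPropagator`, `fullProp_decay_unif`) proved the `K`-uniform off-diagonal decay of King's full `A = 0`
fluctuation propagator `G(K, M, m²) = constrainedProp (L^K) M (aK a L K) ((L^K)²) m²` by peeling (2.17) one level at a time.  THIS FILE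
differentiates the peel in the observation point and runs the same induction for the forward η-derivative
`∂G(K, M, m²)_μ(x, y) := L^K·[G(K, M, m²)(x + e_μ, y) − G(K, M, m²)(x, y)]` (`η⁻¹ = L^K` fine points per unit block):
* §1 **`fullPropD_peel`** ∕ `fullPropD_peel_abs_le` — `∂G(K+1, M_e, m²)_μ(flatten x, flatten y) = (L^{d+1}∕L)·[∂G(K, fine L M_e, m²∕L²)_μ(x, y)
  + ksDSlice (m²∕L²) i μ (x, y)]` (part O-a `fullProp_peel'` at `x + e_μ` and `x`, K-lit `flatten_add`∕`flatten_unitVec`, part K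
  `ksDSlice_eq_fwdDiff`: the gradient piece of part H IS `L^K` times the forward difference of the slice);
* §2 **`fullPropD_decay_unif`** — `∃ C δ > 0, D₀ ≥ 1` (functions of `d, L, a, m₀²`) such that for EVERY `K ≥ 1` (any spelling `N = L^K`), cube
  `M_μ = 2L^e`, mass `0 < m² ≤ m₀²`, direction `μ` and fine `x, y` with `|B(x) − B(y)|_M ≥ D₀`:  `|∂G^η_K,μ(x, y)| ≤ C·e^{−δ|B(x) − B(y)|_M}`.
  INDUCTION ON `K` exactly as in part O-a: base `K = 1` = [Ba 4] (1.10) clause 2 with a point source (`King1986.Torus.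
  constrainedProp_deriv_decay_blocks_unif`, `PropagatorDecayUniform` v1.1); step = §1 at mass `m²∕L²`, the induction hypothesis on the finer
  cube at block distance `D_sub ≥ L(D − 1) + 1`, part M′ `ksDSlice_decay_unif`, and the gain `(2L^{d+1}∕L)·e^{−δ(L−1)(D−1)} ≤ A·e^{−A} ≤ 1`
  for `D ≥ D₀ = 1 + A∕(δ(L−1))`, `A = 2L^{d+1}∕L`.
HONEST SCOPE.  (i) `A = 0`, periodic b.c., odd `L ≥ 3`, `0 < m² ≤ m₀²`, cubes `2L^e`; (ii) lattice units of level `K` (the derivative is the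
forward difference times `L^K`); (iii) OFF-DIAGONAL (on the diagonal `∂G^η_K` grows with `K`); (iv) `K ≥ 1`; (v) not Bałaban's `∇G_k(U)`; not a
discharge.  The two-spacing rate of the gradient (paired induction) is part O-b′.
Locators: [King1986] C. King, CMP **102** (1986) 649–677: (2.13)–(2.17) p. 653, (2.20) p. 654, Theorem 3.3 (3.7) p. 658, Prop. 3.7 (3.63)
p. 663, (4.42)–(4.44) p. 675; [Ba 4] = [Balaban1983RegularityDecay] Theorem (1.10) p. 573 (clause 2).
-/

noncomputable section

namespace Summit.QuantumFields.YangMills.BalabanUVNodes.N15KingModelRung.Curved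

open Real Finset Matrix
open Literature.MathematicalPhysics.QuantumFieldTheory.Balaban1983to89 (Params)
open Literature.MathematicalPhysics.QuantumFieldTheory.Balaban1983to89.B5Prop11Plancherel (Tor fine unitVec)
open Literature.MathematicalPhysics.QuantumFieldTheory.King1986 (aK aK_pos)
open Literature.MathematicalPhysics.QuantumFieldTheory.King1986.Torus (constrainedProp flatten blockOf tdistT
  blockOf_flatten flatten_add flatten_unitVec tdistT_nonneg constrainedProp_deriv_decay_blocks_unif)

variable {d : ℕ} (L : ℕ) [NeZero L]

/-! ## §1 The differentiated peel -/

/-- **THE DIFFERENTIATED PEEL**: for every slice index `i = (e, K = i.j, …)`, `a > 0`, `m² > 0`, `L ≥ 2`, direction `μ` and fine points `x, y`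
of the nested torus, `L^{K+1}·[G(K+1, M_e, m²)(flatten x + e_μ, flatten y) − G(K+1, M_e, m²)(flatten x, flatten y)]
= (L^{d+1}∕L²)·L·[L^K·(G(K, fine L M_e, m²∕L²)(x + e_μ, y) − G(K, fine L M_e, m²∕L²)(x, y)) + ksDSlice (m²∕L²) i μ (x, y)]` — part O-a's peel
at `x + e_μ` and at `x` (the flattened lattice step is the nested lattice step, `flatten_unitVec`), and part K's `ksDSlice_eq_fwdDiff`.
[cite: King1986, (2.17) p.653, (2.20) p.654, Prop. 3.9 (3.73) p.665 (second line, object), (4.42) p.675] -/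
theorem fullPropD_peel (hL : 2 ≤ L) {a msq : ℝ} (ha : 0 < a) (hm : 0 < msq) (i : KSliceIdx d) (μ : Fin (d + 1))
    (x y : Tor (fine (L ^ i.j) (ksU L i))) :
    ((L ^ i.j * L : ℕ) : ℝ) *
        (constrainedProp (L ^ i.j * L) (ksM L i) (aK a L (i.j + 1)) (((L ^ i.j * L : ℕ) : ℝ) ^ 2) msq
            (flatten (L ^ i.j) L (ksM L i) x + unitVec (fine (L ^ i.j * L) (ksM L i)) μ) (flatten (L ^ i.j) L (ksM L i) y)
          - constrainedProp (L ^ i.j * L) (ksM L i) (aK a L (i.j + 1)) (((L ^ i.j * L : ℕ) : ℝ) ^ 2) msq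
            (flatten (L ^ i.j) L (ksM L i) x) (flatten (L ^ i.j) L (ksM L i) y))
      = (L : ℝ) ^ (d + 1) / (L : ℝ) ^ 2 * L *
          (((L ^ i.j : ℕ) : ℝ) *
              (constrainedProp (L ^ i.j) (ksU L i) (aK a L i.j) (((L ^ i.j : ℕ) : ℝ) ^ 2) (msq / (L : ℝ) ^ 2)
                  (x + unitVec (fine (L ^ i.j) (ksU L i)) μ) y
                - constrainedProp (L ^ i.j) (ksU L i) (aK a L i.j) (((L ^ i.j : ℕ) : ℝ) ^ 2) (msq / (L : ℝ) ^ 2) x y)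
            + ksDSlice L a (msq / (L : ℝ) ^ 2) i μ x y) := by
  rw [← flatten_unitVec (L ^ i.j) L (ksM L i) μ, ← flatten_add, fullProp_peel' L hL ha hm i (x + _) y,
    fullProp_peel' L hL ha hm i x y, ksDSlice_eq_fwdDiff]
  push_cast
  ring

/-- **The differentiated peel, triangle-inequality form**: `|∂G(K+1, M_e, m²)_μ(flatten x, flatten y)| ≤ (L^{d+1}∕L²)·L·(|∂G(K, fine L M_e,
m²∕L²)_μ(x, y)| + |ksDSlice (m²∕L²) i μ (x, y)|)`. [cite: King1986, (2.17) p.653, (2.20) p.654] -/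
theorem fullPropD_peel_abs_le (hL : 2 ≤ L) {a msq : ℝ} (ha : 0 < a) (hm : 0 < msq) (i : KSliceIdx d) (μ : Fin (d + 1))
    (x y : Tor (fine (L ^ i.j) (ksU L i))) :
    |((L ^ i.j * L : ℕ) : ℝ) *
        (constrainedProp (L ^ i.j * L) (ksM L i) (aK a L (i.j + 1)) (((L ^ i.j * L : ℕ) : ℝ) ^ 2) msq
            (flatten (L ^ i.j) L (ksM L i) x + unitVec (fine (L ^ i.j * L) (ksM L i)) μ) (flatten (L ^ i.j) L (ksM L i) y)
          - constrainedProp (L ^ i.j * L) (ksM L i) (aK a L (i.j + 1)) (((L ^ i.j * L : ℕ) : ℝ) ^ 2) msq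
            (flatten (L ^ i.j) L (ksM L i) x) (flatten (L ^ i.j) L (ksM L i) y))|
      ≤ (L : ℝ) ^ (d + 1) / (L : ℝ) ^ 2 * L *
          (|((L ^ i.j : ℕ) : ℝ) *
              (constrainedProp (L ^ i.j) (ksU L i) (aK a L i.j) (((L ^ i.j : ℕ) : ℝ) ^ 2) (msq / (L : ℝ) ^ 2)
                  (x + unitVec (fine (L ^ i.j) (ksU L i)) μ) y
                - constrainedProp (L ^ i.j) (ksU L i) (aK a L i.j) (((L ^ i.j : ℕ) : ℝ) ^ 2) (msq / (L : ℝ) ^ 2) x y)|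
            + |ksDSlice L a (msq / (L : ℝ) ^ 2) i μ x y|) := by
  have hΛ : 0 ≤ (L : ℝ) ^ (d + 1) / (L : ℝ) ^ 2 * L := by positivity
  rw [fullPropD_peel L hL ha hm i μ x y, abs_mul, abs_of_nonneg hΛ]
  exact mul_le_mul_of_nonneg_left (abs_add_le _ _) hΛ

/-! ## §2 The uniform off-diagonal decay of the gradient of the full propagator -/

/-- **UNIFORM OFF-DIAGONAL EXPONENTIAL DECAY OF THE GRADIENT `∂^η_μG^η_K` OF KING'S FULL `A = 0` FLUCTUATION PROPAGATOR** (the forward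
η-derivative `L^K·[G^η_K(x + e_μ, y) − G^η_K(x, y)]` of `constrainedProp (L^K) M (aK a L K) ((L^K)²) m²` in the observation point, level-`K`
lattice units): for odd `L ≥ 3`, `a > 0` and a mass cap `m₀² ≥ 0` there are `C, δ > 0` and `D₀ ≥ 1` (functions of `d, L, a, m₀²`) such that for
EVERY `K ≥ 1` (any spelling `N = L^K`), cube `M_μ = 2L^e`, mass `0 < m² ≤ m₀²`, direction `μ` and fine points `x, y` with `|B(x) − B(y)|_M ≥ D₀`:
`|∂^η_μG^η_K(x, y)| ≤ C·e^{−δ·|B(x) − B(y)|_M}` — Theorem 3.3 ∕ Prop. 3.7 (3.63)-type gradient decay for the FULL propagator, uniform in `K`,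
by induction on `K` (§1 + part M′ `ksDSlice_decay_unif` + [Ba 4] (1.10) clause 2 at the bottom).
[cite: King1986, (2.13)–(2.17) p.653, (2.20) p.654, Theorem 3.3 (3.7) p.658, Prop. 3.7 (3.63) p.663, (4.42)–(4.44) p.675; Balaban1983RegularityDecay, Theorem (1.10) p.573] -/
theorem fullPropD_decay_unif (hLodd : Odd L) (hL : 2 ≤ L) {a : ℝ} (ha : 0 < a) {m0sq : ℝ} (hm0 : 0 ≤ m0sq) :
    ∃ C δ D₀ : ℝ, 0 < C ∧ 0 < δ ∧ 1 ≤ D₀ ∧ ∀ (K : ℕ), 1 ≤ K → ∀ (N : ℕ) [NeZero N], N = L ^ K →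
      ∀ (e : ℕ) (M : Fin (d + 1) → ℕ) [∀ μ, NeZero (M μ)], (∀ μ, M μ = 2 * L ^ e) →
      ∀ (msq : ℝ), 0 < msq → msq ≤ m0sq →
      ∀ (μ : Fin (d + 1)) (x y : Tor (fine N M)), D₀ ≤ tdistT M (blockOf N M x) (blockOf N M y) →
        |(N : ℝ) * (constrainedProp N M (aK a L K) (((N : ℕ) : ℝ) ^ 2) msq (x + unitVec (fine N M) μ) y
            - constrainedProp N M (aK a L K) (((N : ℕ) : ℝ) ^ 2) msq x y)|
          ≤ C * Real.exp (-(δ * tdistT M (blockOf N M x) (blockOf N M y))) := by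
  have hL1 : 1 < L := by omega
  have hL1' : (1 : ℝ) ≤ L := by exact_mod_cast hL1.le
  have hL0 : (0 : ℝ) < L := by positivity
  have hLm1 : (1 : ℝ) ≤ (L : ℝ) - 1 := by
    have : (2 : ℝ) ≤ L := by exact_mod_cast hL
    linarith
  -- the base constants ([Ba 4] (1.10) clause 2, point source) and the gradient-piece constants (part M′)
  obtain ⟨δb, cb, hδb, hcb, Hb⟩ := constrainedProp_deriv_decay_blocks_unif (d + 1) L (by omega) ⟨hLodd, hL1⟩ ha hm0
  obtain ⟨Cs, κ, hCs, hκ, Hs⟩ := ksDSlice_decay_unif (d := d) L hLodd hL ha hm0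
  -- the constants of the theorem
  set Λ : ℝ := (L : ℝ) ^ (d + 1) / (L : ℝ) ^ 2 * L with hΛdef
  have hΛ : 0 < Λ := by positivity
  set δ : ℝ := min δb κ with hδdef
  have hδ : 0 < δ := lt_min hδb hκ
  have hδb' : δ ≤ δb := min_le_left _ _
  have hδκ : δ ≤ κ := min_le_right _ _
  set C : ℝ := max ((L : ℝ) ^ (d + 1) * cb) Cs with hCdef
  have hC : 0 < C := lt_max_of_lt_right hCs
  have hCb : (L : ℝ) ^ (d + 1) * cb ≤ C := le_max_left _ _
  have hCsC : Cs ≤ C := le_max_right _ _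
  set A : ℝ := 2 * Λ with hAdef
  have hA : 0 < A := by positivity
  set D₀ : ℝ := 1 + A / (δ * ((L : ℝ) - 1)) with hD₀def
  have hD₀1 : 1 ≤ D₀ := by
    have : 0 ≤ A / (δ * ((L : ℝ) - 1)) := by positivity
    linarith
  refine ⟨C, δ, D₀, hC, hδ, hD₀1, ?_⟩
  intro K hK
  induction K, hK using Nat.le_induction with
  | base =>
    intro N _ hN e M _ hM msq hmsq hcap μ x y _hD
    subst hN
    set P : Params := ⟨d + 1, L, e, 1, by omega, ⟨hLodd, hL1⟩⟩ with hPdef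
    have hMK : ∀ μ, M μ = P.sitesPerDir P.K := fun μ => by
      rw [hM μ]
      simp [hPdef, Params.sitesPerDir]
    have h := Hb P rfl rfl le_rfl msq hmsq.le hcap M hMK (L ^ 1) rfl x y μ
    have hcast : (((L ^ 1 : ℕ) : ℝ)) ^ P.d * cb = (L : ℝ) ^ (d + 1) * cb := by
      simp [hPdef]
    rw [hcast] at h
    have hDnn := tdistT_nonneg M (blockOf (L ^ 1) M x) (blockOf (L ^ 1) M y)
    have hexp : Real.exp (-(δb * tdistT M (blockOf (L ^ 1) M x) (blockOf (L ^ 1) M y)))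
        ≤ Real.exp (-(δ * tdistT M (blockOf (L ^ 1) M x) (blockOf (L ^ 1) M y))) :=
      Real.exp_le_exp.mpr (neg_le_neg (mul_le_mul_of_nonneg_right hδb' hDnn))
    exact h.trans (mul_le_mul hCb hexp (Real.exp_pos _).le hC.le)
  | succ K hK IH =>
    intro N _ hN e M _ hM msq hmsq hcap μ x' y' hD
    subst hN
    obtain rfl : M = fun _ => 2 * L ^ e := funext hM
    set i : KSliceIdx d := ⟨e, K, hK, 1, le_rfl, 0, Nat.zero_le e, 1, le_rfl⟩ with hidef
    obtain ⟨x, rfl⟩ := (flatten (L ^ K) L (ksM L i)).surjective x'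
    obtain ⟨y, rfl⟩ := (flatten (L ^ K) L (ksM L i)).surjective y'
    set D : ℝ := tdistT (fun _ : Fin (d + 1) => 2 * L ^ e) (blockOf (L ^ (K + 1)) (fun _ : Fin (d + 1) => 2 * L ^ e)
        (flatten (L ^ K) L (ksM L i) x)) (blockOf (L ^ (K + 1)) (fun _ : Fin (d + 1) => 2 * L ^ e)
        (flatten (L ^ K) L (ksM L i) y)) with hDdef
    set Dsub : ℝ := tdistT (ksU L i) (blockOf (L ^ K) (ksU L i) x) (blockOf (L ^ K) (ksU L i) y) with hDsubdef
    have hBx : blockOf (L ^ (K + 1)) (fun _ : Fin (d + 1) => 2 * L ^ e) (flatten (L ^ K) L (ksM L i) x)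
        = blockOf L (ksM L i) (blockOf (L ^ K) (ksU L i) x) := blockOf_flatten (L ^ K) L (ksM L i) x
    have hBy : blockOf (L ^ (K + 1)) (fun _ : Fin (d + 1) => 2 * L ^ e) (flatten (L ^ K) L (ksM L i) y)
        = blockOf L (ksM L i) (blockOf (L ^ K) (ksU L i) y) := blockOf_flatten (L ^ K) L (ksM L i) y
    have hgrow : (L : ℝ) * D ≤ Dsub + ((L : ℝ) - 1) := by
      rw [hDdef, hBx, hBy]
      exact mul_tdistT_blockOf_le L (ksM L i) (blockOf (L ^ K) (ksU L i) x) (blockOf (L ^ K) (ksU L i) y)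
    have hD₀D : D₀ ≤ D := hD
    have hDsub_ge : (L : ℝ) * (D - 1) + 1 ≤ Dsub := by linarith
    have hprod : 0 ≤ ((L : ℝ) - 1) * (D - 1) := mul_nonneg (by linarith) (by linarith)
    have hDsub_D₀ : D₀ ≤ Dsub := by linarith
    have hDsub0 : 0 ≤ Dsub := tdistT_nonneg _ _ _
    -- the mass one level down
    have hL2 : (0 : ℝ) < (L : ℝ) ^ 2 := by positivity
    have hm2 : 0 < msq / (L : ℝ) ^ 2 := div_pos hmsq hL2
    have hm2cap : msq / (L : ℝ) ^ 2 ≤ m0sq := by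
      have h1 : (1 : ℝ) ≤ (L : ℝ) ^ 2 := one_le_pow₀ hL1'
      exact (div_le_self hmsq.le h1).trans hcap
    -- the induction hypothesis on the finer cube
    have hM' : ∀ μ, ksU L i μ = 2 * L ^ (e + 1) := fun μ => by
      show L * (2 * L ^ e) = 2 * L ^ (e + 1)
      ring
    have hIH : |((L ^ K : ℕ) : ℝ) *
          (constrainedProp (L ^ K) (ksU L i) (aK a L K) (((L ^ K : ℕ) : ℝ) ^ 2) (msq / (L : ℝ) ^ 2)
              (x + unitVec (fine (L ^ K) (ksU L i)) μ) y
            - constrainedProp (L ^ K) (ksU L i) (aK a L K) (((L ^ K : ℕ) : ℝ) ^ 2) (msq / (L : ℝ) ^ 2) x y)|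
        ≤ C * Real.exp (-(δ * Dsub)) :=
      IH (L ^ K) rfl (e + 1) (ksU L i) hM' (msq / (L : ℝ) ^ 2) hm2 hm2cap μ x y hDsub_D₀
    -- the gradient-piece decay at the finer block distance
    have hS : |ksDSlice L a (msq / (L : ℝ) ^ 2) i μ x y| ≤ Cs * Real.exp (-(κ * Dsub)) :=
      (Hs (msq / (L : ℝ) ^ 2) hm2 hm2cap i μ).1 x y
    have hS' : |ksDSlice L a (msq / (L : ℝ) ^ 2) i μ x y| ≤ C * Real.exp (-(δ * Dsub)) :=
      hS.trans (mul_le_mul hCsC (Real.exp_le_exp.mpr (neg_le_neg (mul_le_mul_of_nonneg_right hδκ hDsub0)))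
        (Real.exp_pos _).le hC.le)
    -- the peel
    have hpeel := fullPropD_peel_abs_le L hL ha hmsq i μ x y
    -- the gain
    have hgainD : A ≤ δ * (((L : ℝ) - 1) * (D - 1)) := by
      have h1 : A / (δ * ((L : ℝ) - 1)) ≤ D - 1 := by linarith
      have h2 : 0 < δ * ((L : ℝ) - 1) := by positivity
      calc A ≤ (D - 1) * (δ * ((L : ℝ) - 1)) := (div_le_iff₀ h2).mp h1
        _ = δ * (((L : ℝ) - 1) * (D - 1)) := by ring
    have hexp : Real.exp (-(δ * Dsub)) ≤ Real.exp (-(δ * D)) * Real.exp (-A) := by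
      rw [← Real.exp_add]
      apply Real.exp_le_exp.mpr
      have h1 : δ * ((L : ℝ) * (D - 1) + 1) ≤ δ * Dsub := mul_le_mul_of_nonneg_left hDsub_ge hδ.le
      have h2 : δ * ((L : ℝ) * (D - 1) + 1) = δ * (((L : ℝ) - 1) * (D - 1)) + δ * D := by ring
      linarith
    have hAexp : A * Real.exp (-A) ≤ 1 := by
      have h1 : A ≤ Real.exp A := by linarith [Real.add_one_le_exp A]
      rw [Real.exp_neg, ← div_eq_mul_inv, div_le_one (Real.exp_pos A)]
      exact h1
    have hgain : A * C * Real.exp (-(δ * Dsub)) ≤ C * Real.exp (-(δ * D)) := by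
      calc A * C * Real.exp (-(δ * Dsub)) ≤ A * C * (Real.exp (-(δ * D)) * Real.exp (-A)) :=
            mul_le_mul_of_nonneg_left hexp (by positivity)
        _ = C * Real.exp (-(δ * D)) * (A * Real.exp (-A)) := by ring
        _ ≤ C * Real.exp (-(δ * D)) * 1 := mul_le_mul_of_nonneg_left hAexp (by positivity)
        _ = C * Real.exp (-(δ * D)) := mul_one _
    -- assemble (the calc is written in the peel's spelling `L^K·L`, `ksM L i`; the goal's `L^(K+1)`, `M_e` is the same term)
    calc |((L ^ K * L : ℕ) : ℝ) *
            (constrainedProp (L ^ K * L) (ksM L i) (aK a L (K + 1)) (((L ^ K * L : ℕ) : ℝ) ^ 2) msq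
                (flatten (L ^ K) L (ksM L i) x + unitVec (fine (L ^ K * L) (ksM L i)) μ) (flatten (L ^ K) L (ksM L i) y)
              - constrainedProp (L ^ K * L) (ksM L i) (aK a L (K + 1)) (((L ^ K * L : ℕ) : ℝ) ^ 2) msq
                (flatten (L ^ K) L (ksM L i) x) (flatten (L ^ K) L (ksM L i) y))|
        ≤ Λ * (|((L ^ K : ℕ) : ℝ) *
              (constrainedProp (L ^ K) (ksU L i) (aK a L K) (((L ^ K : ℕ) : ℝ) ^ 2) (msq / (L : ℝ) ^ 2)
                  (x + unitVec (fine (L ^ K) (ksU L i)) μ) y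
                - constrainedProp (L ^ K) (ksU L i) (aK a L K) (((L ^ K : ℕ) : ℝ) ^ 2) (msq / (L : ℝ) ^ 2) x y)|
            + |ksDSlice L a (msq / (L : ℝ) ^ 2) i μ x y|) := hpeel
      _ ≤ Λ * (C * Real.exp (-(δ * Dsub)) + C * Real.exp (-(δ * Dsub))) :=
          mul_le_mul_of_nonneg_left (add_le_add hIH hS') hΛ.le
      _ = A * C * Real.exp (-(δ * Dsub)) := by rw [hAdef]; ring
      _ ≤ C * Real.exp (-(δ * D)) := hgain

end Summit.QuantumFields.YangMills.BalabanUVNodes.N15KingModelRung.Curved
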